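import Summits.MatrixMultiplication.MatrixMultiplication.Theses.SnSubsetDichotomy

/-!
# Stub stub_squeezeInduction (crux stmt-MatrixMultiplication-8303, line young-host-squeeze)

Combinatorial half of the multinomial squeeze.  For two labellings `f g` of `Fin n` and a
sub-`Finset` `s`, write `rows(s) = ∏_{i ∈ f(s)} |s ∩ f⁻¹ i|!`, `cols(s)` likewise for `g`, and
`cells(s)` for the pair labelling `p ↦ (f p, g p)`.  We show
`rows(s) · cols(s) · exp(κ₁ (|s| - m)) ≤ |s|! · cells(s)`
whenever all blocks have size `≤ B`, given the one-row urn bound `hU` as a hypothesis.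

Proof outline.
* `squeezeInduction_prod_choose_le`: generalised Vandermonde `∏ C(c j, e j) ≤ C(∑ c j, ∑ e j)`.
* Peeling identities: removing one row `R = s ∩ f⁻¹ i₀` (so `s = R ⊔ s'`),
  `rows(s) = |R|! · rows(s')`, `cells(s) = (∏_j e_j!) · cells(s')`,
  `cols(s) = ∏_j C(c_j, e_j) · e_j! · c'_j!`, `cols(s') = ∏_j c'_j!`
  (`c_j, e_j, c'_j` the `g`-fibres of `s, R, s'`, indexed by `j ∈ g(s)`), and
  `|s|! = C(|s|, |R|) · |R|! · |s'|!`.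
* `squeezeInduction_core`: strong induction on `s`; below the threshold `m` a `κ`-free bound
  is used, above it the urn bound `hU` feeds the abstract one-step inequality
  `squeezeInduction_step_ineq`; the `κ`-free bound is the same induction with `κ₁ = 0` and
  Vandermonde in place of `hU` (`squeezeInduction_free`).
-/

set_option linter.dupNamespace false

open scoped BigOperators Classical
open Finset

namespace Summit.MatrixMultiplication.MatrixMultiplication.Theorems.GlobalBranch

/-! ### Generalised Vandermonde -/

/-- One step of the generalised Vandermonde inequality:
`C(a, b) · C(c, d) ≤ C(a + c, b + d)` (one term of Vandermonde's identity). -/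
theorem squeezeInduction_choose_mul_choose_le (a b c d : ℕ) :
    a.choose b * c.choose d ≤ (a + c).choose (b + d) := by
  rw [Nat.add_choose_eq]
  refine Finset.single_le_sum (f := fun ij : ℕ × ℕ => a.choose ij.1 * c.choose ij.2)
    (fun _ _ => Nat.zero_le _) (a := (b, d)) ?_
  simp

/-- Generalised Vandermonde: `∏_{j ∈ J} C(c j, e j) ≤ C(∑_J c j, ∑_J e j)`. -/
theorem squeezeInduction_prod_choose_le (J : Finset ℕ) (c e : ℕ → ℕ) :
    ∏ j ∈ J, (c j).choose (e j) ≤ (∑ j ∈ J, c j).choose (∑ j ∈ J, e j) := by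
  induction J using Finset.induction_on with
  | empty => simp
  | insert a J ha ih =>
    rw [Finset.prod_insert ha, Finset.sum_insert ha, Finset.sum_insert ha]
    exact le_trans (Nat.mul_le_mul_left _ ih) (squeezeInduction_choose_mul_choose_le _ _ _ _)

/-! ### Block products: splitting, constants, supersets -/

/-- Splitting a block product along a sub-`Finset` cut out by a predicate `P` that is constant
on the fibres of the labelling `h`. -/
theorem squeezeInduction_blockProd_split {α γ : Type*} [DecidableEq α] [DecidableEq γ]
    (s : Finset α) (h : α → γ) (P : α → Prop) [DecidablePred P]
    (hP : ∀ p ∈ s, ∀ p' ∈ s, h p = h p' → P p → P p') :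
    ∏ q ∈ s.image h, ((s.filter (fun p => h p = q)).card).factorial =
      (∏ q ∈ (s.filter P).image h,
          (((s.filter P).filter (fun p => h p = q)).card).factorial) *
        ∏ q ∈ (s.filter (fun p => ¬ P p)).image h,
          (((s.filter (fun p => ¬ P p)).filter (fun p => h p = q)).card).factorial := by
  have hdisj : Disjoint ((s.filter P).image h) ((s.filter (fun p => ¬ P p)).image h) := by
    rw [Finset.disjoint_left]
    intro q hq hq'
    obtain ⟨p, hp, rfl⟩ := Finset.mem_image.1 hq
    obtain ⟨p', hp', hpp'⟩ := Finset.mem_image.1 hq'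
    rw [Finset.mem_filter] at hp hp'
    exact hp'.2 (hP p hp.1 p' hp'.1 hpp'.symm hp.2)
  have hunion : s.image h = (s.filter P).image h ∪ (s.filter (fun p => ¬ P p)).image h := by
    rw [← Finset.image_union, Finset.filter_union_filter_not_eq]
  rw [hunion, Finset.prod_union hdisj]
  congr 1
  · refine Finset.prod_congr rfl (fun q hq => ?_)
    obtain ⟨p, hp, rfl⟩ := Finset.mem_image.1 hq
    rw [Finset.mem_filter] at hp
    have key : (s.filter P).filter (fun p' => h p' = h p) = s.filter (fun p' => h p' = h p) := by
      ext p'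
      simp only [Finset.mem_filter]
      constructor
      · rintro ⟨⟨hp's, _⟩, hpp'⟩
        exact ⟨hp's, hpp'⟩
      · rintro ⟨hp's, hpp'⟩
        exact ⟨⟨hp's, hP p hp.1 p' hp's hpp'.symm hp.2⟩, hpp'⟩
    rw [key]
  · refine Finset.prod_congr rfl (fun q hq => ?_)
    obtain ⟨p, hp, rfl⟩ := Finset.mem_image.1 hq
    rw [Finset.mem_filter] at hp
    have key : (s.filter (fun p => ¬ P p)).filter (fun p' => h p' = h p) =
        s.filter (fun p' => h p' = h p) := by
      ext p'
      simp only [Finset.mem_filter]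
      constructor
      · rintro ⟨⟨hp's, _⟩, hpp'⟩
        exact ⟨hp's, hpp'⟩
      · rintro ⟨hp's, hpp'⟩
        exact ⟨⟨hp's, fun hP' => hp.2 (hP p' hp's p hp.1 hpp' hP')⟩, hpp'⟩
    rw [key]

/-- The block product of a labelling that is constant on `R` is `|R|!`. -/
theorem squeezeInduction_blockProd_const {α β : Type*} [DecidableEq β]
    (R : Finset α) (f : α → β) (i₀ : β) (hR : ∀ p ∈ R, f p = i₀) :
    ∏ i ∈ R.image f, ((R.filter (fun p => f p = i)).card).factorial = R.card.factorial := by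
  rcases R.eq_empty_or_nonempty with rfl | hne
  · simp
  · have himg : R.image f = {i₀} := by
      rw [Finset.image_congr (g := fun _ => i₀) (fun p hp => hR p hp), Finset.image_const hne]
    rw [himg, Finset.prod_singleton, Finset.filter_true_of_mem hR]

/-- If `f` is constant on `R`, the cells of the pair labelling `(f, g)` on `R` are the
`g`-blocks of `R`. -/
theorem squeezeInduction_blockProd_pair_const {α β γ : Type*} [DecidableEq β] [DecidableEq γ]
    (R : Finset α) (f : α → β) (g : α → γ) (i₀ : β) (hR : ∀ p ∈ R, f p = i₀) :
    ∏ q ∈ R.image (fun p => (f p, g p)), ((R.filter (fun p => (f p, g p) = q)).card).factorial =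
      ∏ j ∈ R.image g, ((R.filter (fun p => g p = j)).card).factorial := by
  have himg : R.image (fun p => (f p, g p)) = (R.image g).image (fun j => (i₀, j)) := by
    rw [Finset.image_image]
    exact Finset.image_congr (fun p hp => by simp [Function.comp, hR p hp])
  have hinj : Set.InjOn (fun j : γ => (i₀, j)) (R.image g) :=
    fun j _ j' _ hjj' => by simpa using hjj'
  rw [himg, Finset.prod_image hinj]
  refine Finset.prod_congr rfl (fun j _ => ?_)
  rw [Finset.filter_congr (p := fun p => (f p, g p) = (i₀, j)) (q := fun p => g p = j)
    (fun p hp => by simp [hR p hp])]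

/-- A block product may be indexed by any superset of the image (empty blocks give `0! = 1`). -/
theorem squeezeInduction_blockProd_superset {α γ : Type*} [DecidableEq γ]
    (t : Finset α) (g : α → γ) (J : Finset γ) (hJ : t.image g ⊆ J) :
    ∏ j ∈ t.image g, ((t.filter (fun p => g p = j)).card).factorial =
      ∏ j ∈ J, ((t.filter (fun p => g p = j)).card).factorial := by
  refine Finset.prod_subset hJ (fun j _ hj => ?_)
  have h0 : t.filter (fun p => g p = j) = ∅ := by
    rw [Finset.filter_eq_empty_iff]
    intro p hp hpj
    exact hj (Finset.mem_image.2 ⟨p, hp, hpj⟩)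
  rw [h0, Finset.card_empty, Nat.factorial_zero]

/-- Fibre counts split along a row: `c_j = e_j + c'_j`. -/
theorem squeezeInduction_card_fibre_split {α β γ : Type*} [DecidableEq β] [DecidableEq γ]
    (s : Finset α) (f : α → β) (g : α → γ) (i₀ : β) (j : γ) :
    (s.filter (fun p => g p = j)).card =
      ((s.filter (fun p => f p = i₀)).filter (fun p => g p = j)).card +
        ((s.filter (fun p => ¬ f p = i₀)).filter (fun p => g p = j)).card := by
  rw [Finset.filter_comm (p := fun p => f p = i₀) (q := fun p => g p = j) s,
    Finset.filter_comm (p := fun p => ¬ f p = i₀) (q := fun p => g p = j) s,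
    Finset.card_filter_add_card_filter_not]

/-! ### Peeling one row -/

/-- Row peeling: `rows(s) = |R|! · rows(s')` for `R = s ∩ f⁻¹ i₀`, `s' = s ∖ R`. -/
theorem squeezeInduction_rows_peel {α β : Type*} [DecidableEq α] [DecidableEq β]
    (s : Finset α) (f : α → β) (i₀ : β) :
    ∏ i ∈ s.image f, ((s.filter (fun p => f p = i)).card).factorial =
      (s.filter (fun p => f p = i₀)).card.factorial *
        ∏ i ∈ (s.filter (fun p => ¬ f p = i₀)).image f,
          (((s.filter (fun p => ¬ f p = i₀)).filter (fun p => f p = i)).card).factorial := by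
  rw [squeezeInduction_blockProd_split s f (fun p => f p = i₀)
    (fun p _ p' _ hpp' hp => by rw [← hpp', hp])]
  rw [squeezeInduction_blockProd_const (s.filter (fun p => f p = i₀)) f i₀
    (fun p hp => (Finset.mem_filter.1 hp).2)]

/-- Cell peeling: `cells(s) = (∏_{j ∈ g(s)} e_j!) · cells(s')`, where `e_j = |R ∩ g⁻¹ j|`. -/
theorem squeezeInduction_cells_peel {α β γ : Type*} [DecidableEq α] [DecidableEq β]
    [DecidableEq γ] (s : Finset α) (f : α → β) (g : α → γ) (i₀ : β) :
    ∏ q ∈ s.image (fun p => (f p, g p)),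
        ((s.filter (fun p => (f p, g p) = q)).card).factorial =
      (∏ j ∈ s.image g,
          (((s.filter (fun p => f p = i₀)).filter (fun p => g p = j)).card).factorial) *
        ∏ q ∈ (s.filter (fun p => ¬ f p = i₀)).image (fun p => (f p, g p)),
          (((s.filter (fun p => ¬ f p = i₀)).filter (fun p => (f p, g p) = q)).card).factorial := by
  rw [squeezeInduction_blockProd_split s (fun p => (f p, g p)) (fun p => f p = i₀)
    (fun p _ p' _ hpp' hp => by rw [← (Prod.mk.inj hpp').1, hp])]
  rw [squeezeInduction_blockProd_pair_const (s.filter (fun p => f p = i₀)) f g i₀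
    (fun p hp => (Finset.mem_filter.1 hp).2)]
  rw [squeezeInduction_blockProd_superset (s.filter (fun p => f p = i₀)) g (s.image g)
    (Finset.image_subset_image (Finset.filter_subset _ _))]

/-- Column factorisation: `cols(s) = (∏_j C(c_j, e_j)) · (∏_j e_j!) · (∏_j c'_j!)`. -/
theorem squeezeInduction_cols_peel {α β γ : Type*} [DecidableEq β] [DecidableEq γ]
    (s : Finset α) (f : α → β) (g : α → γ) (i₀ : β) :
    ∏ j ∈ s.image g, ((s.filter (fun p => g p = j)).card).factorial =
      (∏ j ∈ s.image g, ((s.filter (fun p => g p = j)).card).choose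
          (((s.filter (fun p => f p = i₀)).filter (fun p => g p = j)).card)) *
        (∏ j ∈ s.image g,
          (((s.filter (fun p => f p = i₀)).filter (fun p => g p = j)).card).factorial) *
        ∏ j ∈ s.image g,
          (((s.filter (fun p => ¬ f p = i₀)).filter (fun p => g p = j)).card).factorial := by
  rw [← Finset.prod_mul_distrib, ← Finset.prod_mul_distrib]
  refine Finset.prod_congr rfl (fun j _ => ?_)
  have hc := squeezeInduction_card_fibre_split s f g i₀ j
  set e := ((s.filter (fun p => f p = i₀)).filter (fun p => g p = j)).card
  set c' := ((s.filter (fun p => ¬ f p = i₀)).filter (fun p => g p = j)).card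
  rw [hc]
  have key := Nat.choose_mul_factorial_mul_factorial (Nat.le_add_right e c')
  rw [Nat.add_sub_cancel_left] at key
  exact key.symm

/-- Columns of the peeled set: `cols(s') = ∏_{j ∈ g(s)} c'_j!`. -/
theorem squeezeInduction_cols_sub {α β γ : Type*} [DecidableEq β] [DecidableEq γ]
    (s : Finset α) (f : α → β) (g : α → γ) (i₀ : β) :
    ∏ j ∈ (s.filter (fun p => ¬ f p = i₀)).image g,
        (((s.filter (fun p => ¬ f p = i₀)).filter (fun p => g p = j)).card).factorial =
      ∏ j ∈ s.image g,
        (((s.filter (fun p => ¬ f p = i₀)).filter (fun p => g p = j)).card).factorial :=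
  squeezeInduction_blockProd_superset _ g (s.image g)
    (Finset.image_subset_image (Finset.filter_subset _ _))

/-- Factorial peeling: `|s|! = C(|s|, |R|) · |R|! · |s'|!`. -/
theorem squeezeInduction_factorial_peel {α β : Type*} [DecidableEq β]
    (s : Finset α) (f : α → β) (i₀ : β) :
    s.card.factorial =
      s.card.choose (s.filter (fun p => f p = i₀)).card *
        (s.filter (fun p => f p = i₀)).card.factorial *
          (s.filter (fun p => ¬ f p = i₀)).card.factorial := by
  have hcard := (Finset.card_filter_add_card_filter_not (s := s) (fun p => f p = i₀)).symm
  have key := Nat.choose_mul_factorial_mul_factorial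
    (Nat.le_add_right (s.filter (fun p => f p = i₀)).card
      (s.filter (fun p => ¬ f p = i₀)).card)
  rw [Nat.add_sub_cancel_left, ← hcard] at key
  exact key.symm

/-! ### The abstract one-step inequality -/

/-- The real-arithmetic core of one peeling step. -/
theorem squeezeInduction_step_ineq {rows' PE PC' cells' P₁ C bF N'F κ b N N' m : ℝ}
    (h0 : 0 ≤ rows') (h1 : 0 ≤ PE) (h2 : 0 ≤ PC') (h4 : 0 ≤ C) (h5 : 0 ≤ bF)
    (hN : N = b + N')
    (hU : P₁ ≤ Real.exp (-(κ * b)) * C)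
    (IH : rows' * PC' * Real.exp (κ * (N' - m)) ≤ N'F * cells') :
    bF * rows' * (P₁ * PE * PC') * Real.exp (κ * (N - m)) ≤
      C * bF * N'F * (PE * cells') := by
  have hE : Real.exp (κ * (N - m)) = Real.exp (κ * b) * Real.exp (κ * (N' - m)) := by
    rw [← Real.exp_add, hN]
    congr 1
    ring
  have hP1 : P₁ * Real.exp (κ * b) ≤ C := by
    have h := mul_le_mul_of_nonneg_right hU (Real.exp_pos (κ * b)).le
    rwa [mul_assoc, mul_comm C, ← mul_assoc, ← Real.exp_add, neg_add_cancel, Real.exp_zero,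
      one_mul] at h
  calc bF * rows' * (P₁ * PE * PC') * Real.exp (κ * (N - m))
      = (bF * rows' * PE * PC' * Real.exp (κ * (N' - m))) * (P₁ * Real.exp (κ * b)) := by
        rw [hE]; ring
    _ ≤ (bF * rows' * PE * PC' * Real.exp (κ * (N' - m))) * C := by
        apply mul_le_mul_of_nonneg_left hP1
        exact mul_nonneg (mul_nonneg (mul_nonneg (mul_nonneg h5 h0) h1) h2) (Real.exp_pos _).le
    _ = (C * bF * PE) * (rows' * PC' * Real.exp (κ * (N' - m))) := by ring
    _ ≤ (C * bF * PE) * (N'F * cells') := by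
        apply mul_le_mul_of_nonneg_left IH
        exact mul_nonneg (mul_nonneg h4 h5) h1
    _ = C * bF * N'F * (PE * cells') := by ring

/-! ### The induction -/

/-- The peeling induction, with the `κ`-free bound below the threshold `m` as hypothesis `hF`. -/
theorem squeezeInduction_core (n : ℕ) (B m κ₁ : ℝ) (hm : 0 ≤ m) (hκ₁ : 0 ≤ κ₁)
    (hU : ∀ (J : Finset ℕ) (c e : ℕ → ℕ) (N b : ℕ), m ≤ (N : ℝ) → N ≤ n →
      (∑ j ∈ J, c j) = N → (∑ j ∈ J, e j) = b → ((b : ℕ) : ℝ) ≤ B →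
      (∀ j ∈ J, ((c j : ℕ) : ℝ) ≤ B) →
      ((∏ j ∈ J, (c j).choose (e j) : ℕ) : ℝ) ≤ Real.exp (-(κ₁ * (b : ℝ))) * ((N.choose b : ℕ) : ℝ))
    (f g : Fin n → ℕ)
    (hF : ∀ s : Finset (Fin n), (s.card : ℝ) < m →
      ((∏ i ∈ s.image f, ((s.filter (fun p => f p = i)).card).factorial : ℕ) : ℝ) *
        ((∏ j ∈ s.image g, ((s.filter (fun p => g p = j)).card).factorial : ℕ) : ℝ) ≤
      ((s.card).factorial : ℝ) *
        ((∏ q ∈ s.image (fun p => (f p, g p)),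
            ((s.filter (fun p => (f p, g p) = q)).card).factorial : ℕ) : ℝ))
    (s : Finset (Fin n))
    (hf : ∀ i, (((s.filter (fun p => f p = i)).card : ℕ) : ℝ) ≤ B)
    (hg : ∀ j, (((s.filter (fun p => g p = j)).card : ℕ) : ℝ) ≤ B) :
    ((∏ i ∈ s.image f, ((s.filter (fun p => f p = i)).card).factorial : ℕ) : ℝ) *
        ((∏ j ∈ s.image g, ((s.filter (fun p => g p = j)).card).factorial : ℕ) : ℝ) *
        Real.exp (κ₁ * ((s.card : ℝ) - m)) ≤
      ((s.card).factorial : ℝ) *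
        ((∏ q ∈ s.image (fun p => (f p, g p)),
            ((s.filter (fun p => (f p, g p) = q)).card).factorial : ℕ) : ℝ) := by
  induction s using Finset.strongInduction with
  | H s ih =>
    rcases s.eq_empty_or_nonempty with rfl | hne
    · have h1 : Real.exp (κ₁ * (((∅ : Finset (Fin n)).card : ℝ) - m)) ≤ 1 := by
        rw [Real.exp_le_one_iff, Finset.card_empty, Nat.cast_zero, zero_sub]
        nlinarith [mul_nonneg hκ₁ hm]
      simpa using h1
    by_cases hsm : (s.card : ℝ) < m
    · have h1 : Real.exp (κ₁ * ((s.card : ℝ) - m)) ≤ 1 := by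
        rw [Real.exp_le_one_iff]
        nlinarith [mul_nonneg hκ₁ (sub_nonneg.2 hsm.le)]
      exact le_trans (mul_le_of_le_one_right (by positivity) h1) (hF s hsm)
    push Not at hsm
    obtain ⟨i₀, hi₀⟩ := hne.image f
    obtain ⟨p₀, hp₀s, hp₀⟩ := Finset.mem_image.1 hi₀
    -- the peeled set is a strict subset
    have hss : s.filter (fun p => ¬ f p = i₀) ⊂ s :=
      Finset.filter_ssubset.2 ⟨p₀, hp₀s, fun h => h hp₀⟩
    -- block-size bounds are inherited by the peeled set
    have hf' : ∀ i, ((((s.filter (fun p => ¬ f p = i₀)).filter (fun p => f p = i)).card : ℕ) : ℝ)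
        ≤ B := fun i =>
      le_trans (Nat.cast_le.2 (Finset.card_le_card
        (Finset.filter_subset_filter _ (Finset.filter_subset _ s)))) (hf i)
    have hg' : ∀ j, ((((s.filter (fun p => ¬ f p = i₀)).filter (fun p => g p = j)).card : ℕ) : ℝ)
        ≤ B := fun j =>
      le_trans (Nat.cast_le.2 (Finset.card_le_card
        (Finset.filter_subset_filter _ (Finset.filter_subset _ s)))) (hg j)
    have IH := ih _ hss hf' hg'
    rw [squeezeInduction_cols_sub s f g i₀] at IH
    -- the urn bound for the peeled row
    have hsn : s.card ≤ n := (Finset.card_le_univ s).trans_eq (Fintype.card_fin n)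
    have hsc : ∑ j ∈ s.image g, (s.filter (fun p => g p = j)).card = s.card :=
      (Finset.card_eq_sum_card_image g s).symm
    have hse : ∑ j ∈ s.image g, ((s.filter (fun p => f p = i₀)).filter (fun p => g p = j)).card =
        (s.filter (fun p => f p = i₀)).card :=
      (Finset.card_eq_sum_card_fiberwise
        (fun p hp => Finset.mem_image_of_mem g (Finset.filter_subset _ s hp))).symm
    have hU' : ((∏ j ∈ s.image g, ((s.filter (fun p => g p = j)).card).choose
          (((s.filter (fun p => f p = i₀)).filter (fun p => g p = j)).card) : ℕ) : ℝ) ≤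
        Real.exp (-(κ₁ * (((s.filter (fun p => f p = i₀)).card : ℕ) : ℝ))) *
          ((s.card.choose (s.filter (fun p => f p = i₀)).card : ℕ) : ℝ) :=
      hU (s.image g) (fun j => (s.filter (fun p => g p = j)).card)
        (fun j => ((s.filter (fun p => f p = i₀)).filter (fun p => g p = j)).card)
        s.card (s.filter (fun p => f p = i₀)).card hsm hsn hsc hse (hf i₀) (fun j _ => hg j)
    have hcard : (s.card : ℝ) = (((s.filter (fun p => f p = i₀)).card : ℕ) : ℝ) +
        (((s.filter (fun p => ¬ f p = i₀)).card : ℕ) : ℝ) := by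
      exact_mod_cast (Finset.card_filter_add_card_filter_not (s := s) (fun p => f p = i₀)).symm
    -- rewrite the goal with the peeling identities and conclude
    rw [squeezeInduction_rows_peel s f i₀, squeezeInduction_cols_peel s f g i₀,
      squeezeInduction_cells_peel s f g i₀, squeezeInduction_factorial_peel s f i₀]
    simp only [Nat.cast_mul]
    exact squeezeInduction_step_ineq (by positivity) (by positivity) (by positivity)
      (by positivity) (by positivity) hcard hU' IH

/-- The `κ`-free bound `rows(s) · cols(s) ≤ |s|! · cells(s)` (i.e. `|Y_f · Y_g| ≤ |s|!`). -/
theorem squeezeInduction_free (n : ℕ) (f g : Fin n → ℕ) (s : Finset (Fin n)) :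
    ((∏ i ∈ s.image f, ((s.filter (fun p => f p = i)).card).factorial : ℕ) : ℝ) *
        ((∏ j ∈ s.image g, ((s.filter (fun p => g p = j)).card).factorial : ℕ) : ℝ) ≤
      ((s.card).factorial : ℝ) *
        ((∏ q ∈ s.image (fun p => (f p, g p)),
            ((s.filter (fun p => (f p, g p) = q)).card).factorial : ℕ) : ℝ) := by
  have hU : ∀ (J : Finset ℕ) (c e : ℕ → ℕ) (N b : ℕ), (0 : ℝ) ≤ (N : ℝ) → N ≤ n →
      (∑ j ∈ J, c j) = N → (∑ j ∈ J, e j) = b → ((b : ℕ) : ℝ) ≤ (n : ℝ) →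
      (∀ j ∈ J, ((c j : ℕ) : ℝ) ≤ (n : ℝ)) →
      ((∏ j ∈ J, (c j).choose (e j) : ℕ) : ℝ) ≤
        Real.exp (-(0 * (b : ℝ))) * ((N.choose b : ℕ) : ℝ) := by
    intro J c e N b _ _ hc he _ _
    rw [zero_mul, neg_zero, Real.exp_zero, one_mul, ← hc, ← he]
    exact_mod_cast squeezeInduction_prod_choose_le J c e
  have hf : ∀ i, (((s.filter (fun p => f p = i)).card : ℕ) : ℝ) ≤ (n : ℝ) := fun i => by
    exact_mod_cast (Finset.card_le_univ _).trans_eq (Fintype.card_fin n)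
  have hg : ∀ j, (((s.filter (fun p => g p = j)).card : ℕ) : ℝ) ≤ (n : ℝ) := fun j => by
    exact_mod_cast (Finset.card_le_univ _).trans_eq (Fintype.card_fin n)
  have h := squeezeInduction_core n (n : ℝ) 0 0 le_rfl le_rfl hU f g
    (fun t ht => absurd ht (by exact_mod_cast Nat.not_lt_zero t.card)) s hf hg
  rw [sub_zero, zero_mul, Real.exp_zero, mul_one] at h
  exact h

/-- **Stub `stub_squeezeInduction`** (line `young-host-squeeze`, crux `GlobalBranch`).
Row-peeling induction: for labellings `f g : Fin n → ℕ` and `s ⊆ Fin n` with all `f`- and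
`g`-blocks of size `≤ B`, given the one-row urn bound `hU` above the threshold `m`,
`rows(s) · cols(s) · exp(κ₁ (|s| - m)) ≤ |s|! · cells(s)`. -/
theorem stub_squeezeInduction (n : ℕ) (B m κ₁ : ℝ) (hm : 0 ≤ m) (hκ₁ : 0 ≤ κ₁)
    (hU : ∀ (J : Finset ℕ) (c e : ℕ → ℕ) (N b : ℕ), m ≤ (N : ℝ) → N ≤ n →
      (∑ j ∈ J, c j) = N → (∑ j ∈ J, e j) = b → ((b : ℕ) : ℝ) ≤ B →
      (∀ j ∈ J, ((c j : ℕ) : ℝ) ≤ B) →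
      ((∏ j ∈ J, (c j).choose (e j) : ℕ) : ℝ) ≤ Real.exp (-(κ₁ * (b : ℝ))) * ((N.choose b : ℕ) : ℝ))
    (s : Finset (Fin n)) (f g : Fin n → ℕ)
    (hf : ∀ i, (((s.filter (fun p => f p = i)).card : ℕ) : ℝ) ≤ B)
    (hg : ∀ j, (((s.filter (fun p => g p = j)).card : ℕ) : ℝ) ≤ B) :
    ((∏ i ∈ s.image f, ((s.filter (fun p => f p = i)).card).factorial : ℕ) : ℝ) *
        ((∏ j ∈ s.image g, ((s.filter (fun p => g p = j)).card).factorial : ℕ) : ℝ) *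
        Real.exp (κ₁ * ((s.card : ℝ) - m)) ≤
      ((s.card).factorial : ℝ) *
        ((∏ q ∈ s.image (fun p => (f p, g p)),
            ((s.filter (fun p => (f p, g p) = q)).card).factorial : ℕ) : ℝ) :=
  squeezeInduction_core n B m κ₁ hm hκ₁ hU f g (fun t _ => squeezeInduction_free n f g t) s hf hg

end Summit.MatrixMultiplication.MatrixMultiplication.Theorems.GlobalBranch
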